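import Summits.ValiantsHypothesis.ValiantsHypothesis.Theorems.LacunarySymmetroidMatrixDescartesFanLawThree

/-!
# `MatrixDescartes` (stmt-ValiantsHypothesis-18050), line `Lift` — the closed-window fan law in CRUX CURRENCY
# (closed fan words: positive zeros, all real zeros, the `MatrixDescartes` inequality on the sector, pivot-column form)

HONEST FRAMING.  Cell `pub-symmetroid`, seat `val-sym-mdr-p2` (gen 3); helper `--supports` the crux
`Theses.LacunarySymmetroid.MatrixDescartes`, NO closure claim.  Word-level corollaries of `…FanLawThree.lean`
(`fanLawThree_lower/upper`), exactly parallel to gen 2's `…FanLawMDR.lean` / `…FanLawTwo.lean` corollaries: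
`fanWordThree_posRoots_le` (`Z₊ ≤ 2m` for closed fan words `∑ₗ X^{dₗ} Sₗ`: pivot letter symmetric, other letters
`⪰ 0`, a factoring letter, every other letter in the closed window with boundary letters `≻ 0`),
`fanWordThree_realRoots_le` (`Z ≤ 4m + 1` when the non-pivot exponents have one parity), `fanWordThree_mdr` (the
crux's inequality `Z^q ≤ 2^{K⌊log₂K⌋}` on this sector at every fat format, via `Census.fatFormat_absorb`), and
`pivotPosRoots_closedFan_le` (the law in the pivot column's currency `Pivot.pivotPosRoots`).  A SECTOR theorem: nothing
here bears on `stub_twoSided` in general, the crux in its window, `DoorA26`/`DoorA34`, or `VP ≠ VNP`.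
[folklore] given `…FanLawThree.lean`.
-/

-- layout Summits/ValiantsHypothesis/ValiantsHypothesis forces the duplicated namespace component
set_option linter.dupNamespace false

namespace Summit.ValiantsHypothesis.ValiantsHypothesis.Theorems.LacunarySymmetroidMatrixDescartes

open Polynomial Matrix Finset
open scoped BigOperators

open FanLawThree

/-- **Closed fan words, positive zeros** (crux currency).  `∑ₗ X^{dₗ} Sₗ` (`K` letters, `m × m`), pivot index `lp`
with `S lp` symmetric, all other letters `⪰ 0`, a factoring letter `lf ≠ lp` with gap `a = |d lf − d lp| > 0`, and
every other letter in one of the four classes (opposite side gap `< a`; opposite side gap `= a` and `≻ 0`; same side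
gap in `(a, 2a)`; same side gap `= 2a` and `≻ 0`) ⇒ at most `2m` distinct positive zeros, for every `K`. [folklore] -/
theorem fanWordThree_posRoots_le (K m : ℕ) (d : Fin K → ℕ) (S : Fin K → Matrix (Fin m) (Fin m) ℝ) (lp lf : Fin K)
    (hne : lf ≠ lp) (hS : (S lp).IsSymm) (hpsd : ∀ l, l ≠ lp → (S l).PosSemidef)
    (hfan : (d lf < d lp ∧ ∀ l, l ≠ lp → l ≠ lf → (d lp < d l ∧ d l - d lp < d lp - d lf)
        ∨ (d l = d lp + (d lp - d lf) ∧ (S l).PosDef)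
        ∨ (d l < d lp ∧ d lp - d lf < d lp - d l ∧ d lp - d l < 2 * (d lp - d lf))
        ∨ (d l + 2 * (d lp - d lf) = d lp ∧ (S l).PosDef))
      ∨ (d lp < d lf ∧ ∀ l, l ≠ lp → l ≠ lf → (d l < d lp ∧ d lp - d l < d lf - d lp)
        ∨ (d l + (d lf - d lp) = d lp ∧ (S l).PosDef)
        ∨ (d lp < d l ∧ d lf - d lp < d l - d lp ∧ d l - d lp < 2 * (d lf - d lp))
        ∨ (d l = d lp + 2 * (d lf - d lp) ∧ (S l).PosDef))) :
    ((Matrix.det (∑ l, ((Polynomial.X : Polynomial ℝ) ^ d l) • (S l).map Polynomial.C)).roots.toFinset.filter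
        (fun t => 0 < t)).card ≤ 2 * m := by
  classical
  -- split the pencil at the pivot index (as in `FanLawMDR.pencil_split`)
  have hsplit : ∑ l, ((Polynomial.X : Polynomial ℝ) ^ d l) • (S l).map Polynomial.C
      = ((Polynomial.X : Polynomial ℝ) ^ d lp) • (S lp).map Polynomial.C
        + ∑ l : {l // l ≠ lp}, ((Polynomial.X : Polynomial ℝ) ^ d l.1) • (S l.1).map Polynomial.C := by
    rw [← Finset.add_sum_erase _ _ (Finset.mem_univ lp),
      Finset.sum_subtype (Finset.univ.erase lp) (p := fun l => l ≠ lp) (fun l => by simp [Finset.mem_erase])]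
  rw [hsplit]
  have hP : ∀ l : {l // l ≠ lp}, (S l.1).PosSemidef := fun l => hpsd l.1 l.2
  rcases hfan with ⟨hlow, h⟩ | ⟨hup, h⟩
  · have := fanLawThree_lower (κ := {l // l ≠ lp}) (d lp) (fun l => d l.1) (S lp) (fun l => S l.1) ⟨lf, hne⟩ hS hP
      hlow fun l hl => h l.1 l.2 fun hll => hl (Subtype.ext hll)
    simpa using this
  · have := fanLawThree_upper (κ := {l // l ≠ lp}) (d lp) (fun l => d l.1) (S lp) (fun l => S l.1) ⟨lf, hne⟩ hS hP
      hup fun l hl => h l.1 l.2 fun hll => hl (Subtype.ext hll)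
    simpa using this

/-- **Closed fan words, all real zeros**: with non-pivot exponents of one parity, `F(−X)` is again a closed fan word
(positive definiteness is preserved), so `det F` has at most `4m + 1` distinct real zeros. [folklore] -/
theorem fanWordThree_realRoots_le (K m : ℕ) (d : Fin K → ℕ) (S : Fin K → Matrix (Fin m) (Fin m) ℝ) (lp lf : Fin K)
    (hne : lf ≠ lp) (hS : (S lp).IsSymm) (hpsd : ∀ l, l ≠ lp → (S l).PosSemidef)
    (hfan : (d lf < d lp ∧ ∀ l, l ≠ lp → l ≠ lf → (d lp < d l ∧ d l - d lp < d lp - d lf)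
        ∨ (d l = d lp + (d lp - d lf) ∧ (S l).PosDef)
        ∨ (d l < d lp ∧ d lp - d lf < d lp - d l ∧ d lp - d l < 2 * (d lp - d lf))
        ∨ (d l + 2 * (d lp - d lf) = d lp ∧ (S l).PosDef))
      ∨ (d lp < d lf ∧ ∀ l, l ≠ lp → l ≠ lf → (d l < d lp ∧ d lp - d l < d lf - d lp)
        ∨ (d l + (d lf - d lp) = d lp ∧ (S l).PosDef)
        ∨ (d lp < d l ∧ d lf - d lp < d l - d lp ∧ d l - d lp < 2 * (d lf - d lp))
        ∨ (d l = d lp + 2 * (d lf - d lp) ∧ (S l).PosDef)))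
    (hpar : (∀ l, l ≠ lp → Even (d l)) ∨ (∀ l, l ≠ lp → Odd (d l))) :
    (Matrix.det (∑ l, ((Polynomial.X : Polynomial ℝ) ^ d l) • (S l).map Polynomial.C)).roots.toFinset.card
      ≤ 4 * m + 1 := by
  have h1 := fanWordThree_posRoots_le K m d S lp lf hne hS hpsd hfan
  have h3 := stub_negRoots K m d S
  -- a family that agrees with `S` off the pivot and is symmetric at the pivot obeys the same bound
  have key : ∀ T : Fin K → Matrix (Fin m) (Fin m) ℝ, (∀ l, l ≠ lp → T l = S l) → (T lp).IsSymm →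
      ((Matrix.det (∑ l, ((Polynomial.X : Polynomial ℝ) ^ d l) • (T l).map Polynomial.C)).roots.toFinset.filter
        (fun t => 0 < t)).card ≤ 2 * m := by
    intro T hT hTs
    refine fanWordThree_posRoots_le K m d T lp lf hne hTs (fun l hl => by rw [hT l hl]; exact hpsd l hl) ?_
    rcases hfan with ⟨h0, h⟩ | ⟨h0, h⟩
    · refine Or.inl ⟨h0, fun l hl hlf => ?_⟩
      rw [hT l hl]; exact h l hl hlf
    · refine Or.inr ⟨h0, fun l hl hlf => ?_⟩
      rw [hT l hl]; exact h l hl hlf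
  have h2 : ((Matrix.det (∑ l, ((Polynomial.X : Polynomial ℝ) ^ d l) •
      (((-1 : ℝ) ^ d l) • S l).map Polynomial.C)).roots.toFinset.filter (fun t => 0 < t)).card ≤ 2 * m := by
    rcases hpar with hev | hodd
    · refine key (fun l => ((-1 : ℝ) ^ d l) • S l) (fun l hl => ?_) (hS.smul _)
      simp only [(hev l hl).neg_one_pow, one_smul]
    · rw [← roots_det_pencil_neg d (fun l => ((-1 : ℝ) ^ d l) • S l)]
      refine key (fun l => -(((-1 : ℝ) ^ d l) • S l)) (fun l hl => ?_) (hS.smul _).neg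
      simp only [(hodd l hl).neg_one_pow, neg_smul, one_smul, neg_neg]
  omega

/-- **`MatrixDescartes` holds on the closed fan sector, at every fat format.**  For all `c, q` there is `K₀` such that
for all `K ≥ K₀`, all `m ≤ 2^((⌊log₂K⌋+c)^c)`, all exponents and letters forming a closed fan word (pivot `lp`
symmetric, other letters `⪰ 0`, factoring letter `lf`, every other letter in one of the four classes, boundary letters
`≻ 0`, non-pivot exponents of one parity): `Z^q ≤ 2^(K⌊log₂K⌋)`.  Nothing is claimed outside the sector. [folklore] -/
theorem fanWordThree_mdr (c q : ℕ) : ∃ K₀ : ℕ, ∀ K m : ℕ, K₀ ≤ K → m ≤ 2 ^ ((Nat.log 2 K + c) ^ c) →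
    ∀ (d : Fin K → ℕ) (S : Fin K → Matrix (Fin m) (Fin m) ℝ) (lp lf : Fin K), lf ≠ lp → (S lp).IsSymm →
      (∀ l, l ≠ lp → (S l).PosSemidef) →
      ((d lf < d lp ∧ ∀ l, l ≠ lp → l ≠ lf → (d lp < d l ∧ d l - d lp < d lp - d lf)
          ∨ (d l = d lp + (d lp - d lf) ∧ (S l).PosDef)
          ∨ (d l < d lp ∧ d lp - d lf < d lp - d l ∧ d lp - d l < 2 * (d lp - d lf))
          ∨ (d l + 2 * (d lp - d lf) = d lp ∧ (S l).PosDef))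
        ∨ (d lp < d lf ∧ ∀ l, l ≠ lp → l ≠ lf → (d l < d lp ∧ d lp - d l < d lf - d lp)
          ∨ (d l + (d lf - d lp) = d lp ∧ (S l).PosDef)
          ∨ (d lp < d l ∧ d lf - d lp < d l - d lp ∧ d l - d lp < 2 * (d lf - d lp))
          ∨ (d l = d lp + 2 * (d lf - d lp) ∧ (S l).PosDef))) →
      ((∀ l, l ≠ lp → Even (d l)) ∨ (∀ l, l ≠ lp → Odd (d l))) →
      (Matrix.det (∑ l, ((Polynomial.X : Polynomial ℝ) ^ d l) • (S l).map Polynomial.C)).roots.toFinset.card ^ q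
        ≤ 2 ^ (K * Nat.log 2 K) := by
  obtain ⟨K₀, hK₀⟩ := Census.fatFormat_absorb 2 c q
  refine ⟨K₀, fun K m hK hm d S lp lf hne hS hpsd hfan hpar => hK₀ K m _ hK hm ?_⟩
  have h := fanWordThree_realRoots_le K m d S lp lf hne hS hpsd hfan hpar
  have : 4 * m + 1 ≤ 2 ^ 2 * (m + 1) * (K + 1) := by nlinarith
  exact h.trans this

/-- The closed fan laws in the census currency of the pivot column (`…CensusPivotDefs`): `pivotPosRoots e d J P ≤ 2m`
uniformly in `K` and in the pivot index, whenever a factoring letter exists in the closed window (boundary letters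
positive definite). [folklore] -/
theorem pivotPosRoots_closedFan_le (m K e : ℕ) (d : Fin K → ℕ) (J : Matrix (Fin m) (Fin m) ℝ)
    (P : Fin K → Matrix (Fin m) (Fin m) ℝ) (k₀ : Fin K) (hJ : J.IsSymm) (hP : ∀ k, (P k).PosSemidef)
    (hfan : (d k₀ < e ∧ ∀ k, k ≠ k₀ → (e < d k ∧ d k - e < e - d k₀)
        ∨ (d k = e + (e - d k₀) ∧ (P k).PosDef)
        ∨ (d k < e ∧ e - d k₀ < e - d k ∧ e - d k < 2 * (e - d k₀))
        ∨ (d k + 2 * (e - d k₀) = e ∧ (P k).PosDef))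
      ∨ (e < d k₀ ∧ ∀ k, k ≠ k₀ → (d k < e ∧ e - d k < d k₀ - e)
        ∨ (d k + (d k₀ - e) = e ∧ (P k).PosDef)
        ∨ (e < d k ∧ d k₀ - e < d k - e ∧ d k - e < 2 * (d k₀ - e))
        ∨ (d k = e + 2 * (d k₀ - e) ∧ (P k).PosDef))) :
    Pivot.pivotPosRoots e d J P ≤ 2 * m := by
  unfold Pivot.pivotPosRoots
  rcases hfan with ⟨hlow, h⟩ | ⟨hup, h⟩
  · simpa using fanLawThree_lower e d J P k₀ hJ hP hlow h
  · simpa using fanLawThree_upper e d J P k₀ hJ hP hup h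

end Summit.ValiantsHypothesis.ValiantsHypothesis.Theorems.LacunarySymmetroidMatrixDescartes
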